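import Literature.AnabelianGeometry.EtaleTheta.Discharge.Sec4Prop43iiiKummerClass
import Literature.AnabelianGeometry.EtaleTheta.Discharge.Sec4Prop43iiiModelHolds
import Literature.AnabelianGeometry.EtaleTheta.Discharge.Sec5OfConnectedTemperoid

/-!
# [EtTh] Prop 4.3 (iii), SECOND CLAUSE without `Φ` divisorial — and at the §5 data of record

S. Mochizuki, *The étale theta function and its Frobenioid-theoretic manifestations*, Publ. RIMS **45** (2009)
[EtTh], §4, Proposition 4.3 (iii), printed p.317 (PDF p.91), verbatim (own render, `paper:doi-10-2977-prims-1234361159`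
p.91 l.17–22): "(iii) In the notation of (i), the difference `s'_N{}^{gp} · (s''_N{}^{gp})⁻¹` determines a twisted
homomorphism `H_{B_N} → μ_N(B_N)`, hence an element of the cohomology module `H¹(H_{B_N}, μ_N(B_N))`, which is equal to
the Kummer class [cf. [Mzk18], Definition 2.1, (ii)] `κ_{f|_{B_N}} ∈ H¹(H_{B_N}, μ_N(B_N))` of `f|_{B_N}` ….  In particular,
this cohomology class is independent of the [simultaneous and non-simultaneous] conjugation operations discussed in
(ii)."  Printed proof (p.317 l.32–33): "Assertion (iii) follows immediately from the definitions [cf., especially,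
[Mzk18], Definition 2.1, (ii)]." [cite: MochizukiEtTh2009, Prop 4.3 (iii) p.317 (PDF p.91)]

abc-iut cell, layer L2, cone node `EtTh:Prop4.3(iii)`, seat abc-iut-w6-d078 (gen 5).  PROOF-ONLY companion (no `def`,
no `instance`, no named `Prop` fact) of abc-iut-L2-t3's `Discharge/Sec4Prop43iiiKummerClass.lean` (the SECOND CLAUSE
«= κ_{f|_{B_N}}» at the model instances `mkOfModel`, there modulo `hΦd : Φ divisorial`) and of abc-iut-f-111's
`Discharge/Sec4Prop43iiiModelHolds.lean` (the FIRST clause with `Φ` divisorial REMOVED, via "`Φ^{bs-fld}(A)` monoprime",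
Def 3.6 (ii)(a), `BiKummerRoot.sNum_mul_sDen_inv_pow_eq_one'`).  This file runs L2-t3's second-clause chain on f-111's
divisoriality-free torsion lemma, so that the Kummer-class comparison, too, holds with NO hypothesis beyond the model
setting's own data, and records it at the §5 data of record `mkOfConnectedTemperoid` (abc-iut-L2-t4,
`Discharge/Sec5OfConnectedTemperoid.lean`; `mkOfConnectedTemperoid = mkOfModelCanonical = mkOfModel` definitionally):

* `BiKummerRoot.diffUnit_pow_eq_one'` — `u_{w(h)}^N = 1` for the bi-Kummer difference `w(h) = s''(h)·s'(h)⁻¹`, NO `hΦd`;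
* `BiKummerRoot.isFixedByHA_restrict_pow_mkOfModel'` — `f|_{B_N} = g^N` (`g := f_N|_{B_N}`) is `H_{B_N}`-fixed, NO `hΦd`;
* `BiKummerRoot.toUnits_diffUnit_mem_rootsOfUnity` — `u_{w(h)} ∈ μ_N(B_N^birat)`;
* `BiKummerRoot.kummerCocycle_restrict_eq'` — **the [FrdII] Def 2.1 (ii) Kummer cocycle of `f|_{B_N}` attached to the root
  `g` takes at `h` the value `u_{w(h)}`** (print's "twisted homomorphism determined by the difference"), NO `hΦd`;
  `BiKummerRoot.val_kummerCocycle_restrict` — the same on underlying rational functions, def-free shape;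
* `BiKummerRoot.isMulCocycle₁_diffUnit` / **`BiKummerRoot.kummerClassOfRoot_restrict_eq'`** — the `H¹` form: `κ_{f|_{B_N}}`
  (`BiKummerSetting.kummerClassOfRoot`, abc-iut-L2-t3 `BiKummerKummerClass.lean`) EQUALS the class of `h ↦ u_{w(h)}`, NO `hΦd`;
  `BiKummerRoot.diffClass_eq_of_biKummerRoot'` — "In particular": any two bi-Kummer roots of the same `N`-th root give
  the same class;  `BiKummerRoot.diffCocycle_eq_mk` — agreement with L2-t3's named `diffCocycle` when `hΦd` IS supplied;
* §3, at `mkOfConnectedTemperoid` (Hom- and monoid-universe `0`, as Mathlib's `groupCohomology` requires — note 3 of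
  `BiKummerKummerClass.lean`): `isFixedByHA_restrict_pow_mkOfConnectedTemperoid`, `val_kummerCocycle_restrict_mkOfConnectedTemperoid`,
  **`kummerClassOfRoot_restrict_eq_mkOfConnectedTemperoid`** — together with abc-iut-w6-d050's
  `prop43_iii_mkOfConnectedTemperoid` (clause 1, `Sec4Prop43NodesReclosedIsGalois.lean`) and abc-iut-w6-d077's
  unconditional cocycle / independence identities (`Sec4Prop43iiiCocycle.lean`), every printed clause of Prop 4.3 (iii)
  now holds at the §5 data of record with no binder beyond the structure's own data.
SIGN CONVENTION as recorded by abc-iut-L2-t3 (header of `Sec4Prop43iiiKummerClass.lean`): with the tree's `h·g = ζ_h·g` the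
kernel gives `ζ_h = u_{s''(h)·s'(h)⁻¹}`; the class of print's `s'·(s'')⁻¹` is `−κ`, the same datum.
HONEST FRAMING: refereed pre-IUT material ([EtTh] 2009 over [FrdI]/[FrdII] 2008); bookkeeping over landed theorems, no
new mathematics; nothing here asserts that such data exist for an actual curve; nothing bears on [IUTchIII] Cor. 3.12
and no side is taken; typed ≠ proved — here PROVED.
-/

noncomputable section

namespace Literature.AnabelianGeometry.EtaleTheta

open CategoryTheory Opposite Literature.AlgebraicGeometry.Frobenioids groupCohomology
open Literature.AnabelianGeometry.SemiGraphs Literature.AnabelianGeometry.SemiGraphs.GaloisObjects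

universe u₀ v₀ u v w

variable {Kf : Type u₀} [Field Kf]

namespace BiKummerSetting

namespace BiKummerRoot

/-! ### §1. At the model instances `mkOfModel`: the torsion and fixedness facts without `Φ` divisorial -/

section Model

variable (X : SemiGraphs.TemperedArithmeticGroup.{u₀} Kf) {D₀ : Type u₀} [Category.{v₀} D₀]
  {V : FrdIMonoidStub.{w}} {T : RealifiedDivisorMonoids (D₀ := D₀) V} {D : Type u} [Category.{v} D]
  {VD : FrdICatStub.{u, v, w} D}
  (tf : TemperedFrobenioid T D VD) (hZ : tf.monoidType = MonoidType.Z)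
  (hP : ∀ A : Dᵒᵖ, IsPerfect (tf.Φ.carrier A)) (hBΛ : ∀ (Y : D₀ᵒᵖ) (b : T.BΛ.obj Y), IsUnit b)
  (DS : ∀ {A : Dᵒᵖ}, tf.Φ.carrier A → tf.Φ.carrier A → Prop) (IG : D → Prop)
  (gS : ∀ A : D, IG A → (X.Pi →* Aut A)) (gSs : ∀ (A : D) (h : IG A), Function.Surjective (gS A h))
  (NH : Subgroup (Field.absoluteGaloisGroup Kf) → tf.category → ℕ+ → Prop)
  (AB : ∀ {A B : tf.category}, Subgroup (Aut A) → (A ⟶ A) → (A ⟶ B) → Prop) (A₀ : tf.category)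
  (hA₀ : PreFrobenioid.IsFrobeniusTrivial tf.toElem A₀) (hA₀' : IG A₀.base)
  {A B : tf.category} {f : tf.biratUnitsModel A}
  {P : (mkOfModel X tf hZ hP hBΛ DS IG gS gSs NH AB A₀ hA₀ hA₀').FractionPair f B} {N : ℕ+}
  {pullFrac : ∀ {A A' : tf.category} (_ : A' ⟶ A), tf.biratUnitsModel A → tf.biratUnitsModel A'}
  {R : (mkOfModel X tf hZ hP hBΛ DS IG gS gSs NH AB A₀ hA₀ hA₀').NthRoot f P N pullFrac}
  {hA : (mkOfModel X tf hZ hP hBΛ DS IG gS gSs NH AB A₀ hA₀ hA₀').IsGalois R.AN}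
  {hB : (mkOfModel X tf hZ hP hBΛ DS IG gS gSs NH AB A₀ hA₀ hA₀').IsGalois R.BN}
  (K : (mkOfModel X tf hZ hP hBΛ DS IG gS gSs NH AB A₀ hA₀ hA₀').BiKummerRoot R hA hB)

/-- **`u_{w(h)}^N = 1` with NO divisoriality hypothesis**: the rational function of the bi-Kummer difference
`w(h) = s''(h)·s'(h)⁻¹ ∈ O^×(B_N)` is killed by `N` (abc-iut-f-111's `sNum_mul_sDen_inv_pow_eq_one'` — monoprime
`Φ^{bs-fld}`, Def 3.6 (ii)(a) — at the identity dictionary of the model, then `O^×(B_N) → O^×(B_N^birat)`).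
[cite: MochizukiEtTh2009, Prop 4.3 (iii) p.317 (PDF p.91)] -/
theorem diffUnit_pow_eq_one' (h : (mkOfModel X tf hZ hP hBΛ DS IG gS gSs NH AB A₀ hA₀ hA₀').HA R.BN hB) :
    K.diffUnit X tf hZ hP hBΛ DS IG gS gSs NH AB A₀ hA₀ hA₀' h ^ (N : ℕ) = 1 := by
  have e : K.sDen h * (K.sNum h)⁻¹ = (K.sNum h * (K.sDen h)⁻¹)⁻¹ := by rw [mul_inv_rev, inv_inv]
  have hw : (K.sDen h * (K.sNum h)⁻¹) ^ (N : ℕ) = 1 := by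
    rw [e, inv_pow, K.sNum_mul_sDen_inv_pow_eq_one' (fun A => MonoidHom.id (tf.biratUnitsModel A))
      (fun s' s'' _ _ _ => coe_fracOfModel_mul_unit tf hBΛ s' s'') (fun σ x => coe_biratAutModel_eq_pull tf σ x) h,
      inv_one]
  have h1 : (⟨K.sDen h * (K.sNum h)⁻¹, K.sDen_mul_sNum_inv_mem_units X tf hZ hP hBΛ DS IG gS gSs NH AB A₀ hA₀ hA₀'
      h⟩ : ModelFrobenioid.units R.BN) ^ (N : ℕ) = 1 :=
    Subtype.ext (by rw [SubmonoidClass.coe_pow, OneMemClass.coe_one]; exact hw)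
  have h2 := congrArg (ModelFrobenioid.unitsToRatFn R.BN) h1
  rw [map_pow, map_one] at h2
  exact h2

/-- **`f|_{B_N} = g^N` is `H_{B_N}`-fixed with NO divisoriality hypothesis** (`g := f_N|_{B_N}`), granted a bi-Kummer root
`K`: `h · g^N = (u_{w(h)} · g)^N = g^N`. [cite: MochizukiEtTh2009, Prop 4.3 (iii) p.317 (PDF p.91)] -/
theorem isFixedByHA_restrict_pow_mkOfModel'
    (K : (mkOfModel X tf hZ hP hBΛ DS IG gS gSs NH AB A₀ hA₀ hA₀').BiKummerRoot R hA hB) :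
    (mkOfModel X tf hZ hP hBΛ DS IG gS gSs NH AB A₀ hA₀ hA₀').IsFixedByHA R.BN hB (R.pair.restrict ^ (N : ℕ)) := by
  intro σ hσ
  rw [map_pow]
  change ((mkOfModel X tf hZ hP hBΛ DS IG gS gSs NH AB A₀ hA₀ hA₀').biratAut R.BN
    ((⟨σ, hσ⟩ : (mkOfModel X tf hZ hP hBΛ DS IG gS gSs NH AB A₀ hA₀ hA₀').HA R.BN hB) : Aut R.BN) R.pair.restrict) ^
      (N : ℕ) = _
  rw [K.biratAut_restrict_mkOfModel, mul_pow, K.diffUnit_pow_eq_one' X tf hZ hP hBΛ DS IG gS gSs NH AB A₀ hA₀ hA₀',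
    one_mul]

end Model

/-! ### §2. The second clause in `H¹(H_{B_N}, μ_N)` without `Φ` divisorial (Hom- and monoid-universe `0`) -/

section KummerClass

variable (X : SemiGraphs.TemperedArithmeticGroup.{u₀} Kf) {D₀ : Type u₀} [Category.{v₀} D₀]
  {V : FrdIMonoidStub.{0}} {T : RealifiedDivisorMonoids (D₀ := D₀) V} {D : Type u} [Category.{0} D]
  {VD : FrdICatStub.{u, 0, 0} D}
  (tf : TemperedFrobenioid T D VD) (hZ : tf.monoidType = MonoidType.Z)
  (hP : ∀ A : Dᵒᵖ, IsPerfect (tf.Φ.carrier A)) (hBΛ : ∀ (Y : D₀ᵒᵖ) (b : T.BΛ.obj Y), IsUnit b)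
  (DS : ∀ {A : Dᵒᵖ}, tf.Φ.carrier A → tf.Φ.carrier A → Prop) (IG : D → Prop)
  (gS : ∀ A : D, IG A → (X.Pi →* Aut A)) (gSs : ∀ (A : D) (h : IG A), Function.Surjective (gS A h))
  (NH : Subgroup (Field.absoluteGaloisGroup Kf) → tf.category → ℕ+ → Prop)
  (AB : ∀ {A B : tf.category}, Subgroup (Aut A) → (A ⟶ A) → (A ⟶ B) → Prop) (A₀ : tf.category)
  (hA₀ : PreFrobenioid.IsFrobeniusTrivial tf.toElem A₀) (hA₀' : IG A₀.base)
  {A B : tf.category} {f : tf.biratUnitsModel A}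
  {P : (mkOfModel X tf hZ hP hBΛ DS IG gS gSs NH AB A₀ hA₀ hA₀').FractionPair f B} {N : ℕ+}
  {pullFrac : ∀ {A A' : tf.category} (_ : A' ⟶ A), tf.biratUnitsModel A → tf.biratUnitsModel A'}
  {R : (mkOfModel X tf hZ hP hBΛ DS IG gS gSs NH AB A₀ hA₀ hA₀').NthRoot f P N pullFrac}
  {hA : (mkOfModel X tf hZ hP hBΛ DS IG gS gSs NH AB A₀ hA₀ hA₀').IsGalois R.AN}
  {hB : (mkOfModel X tf hZ hP hBΛ DS IG gS gSs NH AB A₀ hA₀ hA₀').IsGalois R.BN}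
  (K : (mkOfModel X tf hZ hP hBΛ DS IG gS gSs NH AB A₀ hA₀ hA₀').BiKummerRoot R hA hB)

/-- `u_{w(h)} ∈ μ_N(B_N^birat)` — the cyclotomic portion of order `N` ([FrdII] Def 2.1 (i)), NO divisoriality hypothesis.
[cite: MochizukiEtTh2009, Prop 4.3 (iii) p.317 (PDF p.91)] -/
theorem toUnits_diffUnit_mem_rootsOfUnity (h : (mkOfModel X tf hZ hP hBΛ DS IG gS gSs NH AB A₀ hA₀ hA₀').HA R.BN hB) :
    toUnits (BiratCoeff.of R.BN (K.diffUnit X tf hZ hP hBΛ DS IG gS gSs NH AB A₀ hA₀ hA₀' h)) ∈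
      rootsOfUnity (N : ℕ) ((mkOfModel X tf hZ hP hBΛ DS IG gS gSs NH AB A₀ hA₀ hA₀').BiratCoeff R.BN) := by
  rw [mem_rootsOfUnity, ← map_pow, ← map_pow, K.diffUnit_pow_eq_one' X tf hZ hP hBΛ DS IG gS gSs NH AB A₀ hA₀ hA₀',
    map_one, map_one]

/-- **The Kummer cocycle of `f|_{B_N}` IS the bi-Kummer difference, with NO divisoriality hypothesis**: the
[FrdII] Def 2.1 (ii) cocycle of the root `g = f_N|_{B_N}` (tree convention `h·g = ζ_h·g`; `H_{B_N}`-fixedness of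
`f|_{B_N} = g^N` by `isFixedByHA_restrict_pow_mkOfModel'`) has `ζ_h = u_{w(h)}` for every `h ∈ H_{B_N}` — print's
"the difference … determines a twisted homomorphism `H_{B_N} → μ_N(B_N)`" read against "[Mzk18], Definition 2.1, (ii)".
[cite: MochizukiEtTh2009, Prop 4.3 (iii) p.317 (PDF p.91)] -/
theorem kummerCocycle_restrict_eq' (h : (mkOfModel X tf hZ hP hBΛ DS IG gS gSs NH AB A₀ hA₀ hA₀').HA R.BN hB) :
    Kummer.kummerCocycle (BiratCoeff.nthRootsDifferByUnits _ R.BN N)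
        ((mkOfModel X tf hZ hP hBΛ DS IG gS gSs NH AB A₀ hA₀ hA₀').HA R.BN hB)
        (f := BiratCoeff.of R.BN (R.pair.restrict ^ (N : ℕ))) (g := BiratCoeff.of R.BN R.pair.restrict) rfl
        (BiratCoeff.smul_of_eq_of_isFixedByHA
          (K.isFixedByHA_restrict_pow_mkOfModel' X tf hZ hP hBΛ DS IG gS gSs NH AB A₀ hA₀ hA₀')) h =
      Kummer.Mu.mk (toUnits (BiratCoeff.of R.BN (K.diffUnit X tf hZ hP hBΛ DS IG gS gSs NH AB A₀ hA₀ hA₀' h)))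
        (K.toUnits_diffUnit_mem_rootsOfUnity X tf hZ hP hBΛ DS IG gS gSs NH AB A₀ hA₀ hA₀' h) := by
  apply Kummer.kummerCocycle_eq_of_smul_eq
  rw [Kummer.Mu.val_mk, val_toUnits_apply, BiratCoeff.smul_of, ← map_mul]
  exact congrArg (BiratCoeff.of R.BN) (K.biratAut_restrict_mkOfModel X tf hZ hP hBΛ DS IG gS gSs NH AB A₀ hA₀ hA₀' h)

/-- Def-free shape of the same identity, on underlying rational functions: the value at `h` of the Kummer cocycle of
`f|_{B_N}` has underlying birational unit `u_{w(h)}`, whose rational function is `unit (s''(h)·s'(h)⁻¹)`.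
[cite: MochizukiEtTh2009, Prop 4.3 (iii) p.317 (PDF p.91)] -/
theorem val_kummerCocycle_restrict (h : (mkOfModel X tf hZ hP hBΛ DS IG gS gSs NH AB A₀ hA₀ hA₀').HA R.BN hB) :
    (((Kummer.kummerCocycle (BiratCoeff.nthRootsDifferByUnits _ R.BN N)
        ((mkOfModel X tf hZ hP hBΛ DS IG gS gSs NH AB A₀ hA₀ hA₀').HA R.BN hB)
        (f := BiratCoeff.of R.BN (R.pair.restrict ^ (N : ℕ))) (g := BiratCoeff.of R.BN R.pair.restrict) rfl
        (BiratCoeff.smul_of_eq_of_isFixedByHA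
          (K.isFixedByHA_restrict_pow_mkOfModel' X tf hZ hP hBΛ DS IG gS gSs NH AB A₀ hA₀ hA₀')) h).val :
        (mkOfModel X tf hZ hP hBΛ DS IG gS gSs NH AB A₀ hA₀ hA₀').BiratCoeff R.BN) : (mkOfModel X tf hZ hP hBΛ DS IG gS
          gSs NH AB A₀ hA₀ hA₀').biratUnits R.BN).val =
      ModelFrobenioid.unit (K.sDen h * (K.sNum h)⁻¹ : Aut R.BN).hom := by
  rw [K.kummerCocycle_restrict_eq' X tf hZ hP hBΛ DS IG gS gSs NH AB A₀ hA₀ hA₀' h]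
  rfl

/-- `h ↦ u_{w(h)}` is a `1`-cocycle of `H_{B_N}` in `μ_N(B_N^birat)` (it IS the Kummer cocycle), NO divisoriality hypothesis.
[cite: MochizukiEtTh2009, Prop 4.3 (iii) p.317 (PDF p.91)] -/
theorem isMulCocycle₁_diffUnit :
    IsMulCocycle₁ (fun h : (mkOfModel X tf hZ hP hBΛ DS IG gS gSs NH AB A₀ hA₀ hA₀').HA R.BN hB =>
      Kummer.Mu.mk (toUnits (BiratCoeff.of R.BN (K.diffUnit X tf hZ hP hBΛ DS IG gS gSs NH AB A₀ hA₀ hA₀' h)))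
        (K.toUnits_diffUnit_mem_rootsOfUnity X tf hZ hP hBΛ DS IG gS gSs NH AB A₀ hA₀ hA₀' h)) := by
  have e : (fun h : (mkOfModel X tf hZ hP hBΛ DS IG gS gSs NH AB A₀ hA₀ hA₀').HA R.BN hB =>
      Kummer.Mu.mk (toUnits (BiratCoeff.of R.BN (K.diffUnit X tf hZ hP hBΛ DS IG gS gSs NH AB A₀ hA₀ hA₀' h)))
        (K.toUnits_diffUnit_mem_rootsOfUnity X tf hZ hP hBΛ DS IG gS gSs NH AB A₀ hA₀ hA₀' h)) =
      Kummer.kummerCocycle (BiratCoeff.nthRootsDifferByUnits _ R.BN N)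
        ((mkOfModel X tf hZ hP hBΛ DS IG gS gSs NH AB A₀ hA₀ hA₀').HA R.BN hB)
        (f := BiratCoeff.of R.BN (R.pair.restrict ^ (N : ℕ))) (g := BiratCoeff.of R.BN R.pair.restrict) rfl
        (BiratCoeff.smul_of_eq_of_isFixedByHA
          (K.isFixedByHA_restrict_pow_mkOfModel' X tf hZ hP hBΛ DS IG gS gSs NH AB A₀ hA₀ hA₀')) :=
    funext fun h => (K.kummerCocycle_restrict_eq' X tf hZ hP hBΛ DS IG gS gSs NH AB A₀ hA₀ hA₀' h).symm
  rw [e]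
  exact Kummer.isMulCocycle₁_kummerCocycle _ _ _ _

/-- **[EtTh] Prop 4.3 (iii), SECOND CLAUSE, with NO divisoriality hypothesis** (every model instance `mkOfModel`):
the Kummer class `κ_{f|_{B_N}} ∈ H¹(H_{B_N}, μ_N)` ([FrdII] Def 2.1 (ii), `BiKummerSetting.kummerClassOfRoot` from the root
`g = f_N|_{B_N}`) EQUALS the class of the twisted homomorphism `h ↦ u_{w(h)}` determined by the bi-Kummer difference.
[cite: MochizukiEtTh2009, Prop 4.3 (iii) p.317 (PDF p.91)] -/
theorem kummerClassOfRoot_restrict_eq' :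
    (mkOfModel X tf hZ hP hBΛ DS IG gS gSs NH AB A₀ hA₀ hA₀').kummerClassOfRoot hB (N : ℕ)
        (f := R.pair.restrict ^ (N : ℕ)) (g := R.pair.restrict) rfl
        (K.isFixedByHA_restrict_pow_mkOfModel' X tf hZ hP hBΛ DS IG gS gSs NH AB A₀ hA₀ hA₀') =
      H1π _ (cocyclesOfIsMulCocycle₁ (K.isMulCocycle₁_diffUnit X tf hZ hP hBΛ DS IG gS gSs NH AB A₀ hA₀ hA₀')) := by
  rw [kummerClassOfRoot, Kummer.kummerClassOfRoot]
  congr 1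
  refine cocycles₁_ext fun h => ?_
  change Additive.ofMul (Kummer.kummerCocycle _ _ _ _ h) =
    Additive.ofMul (Kummer.Mu.mk (toUnits (BiratCoeff.of R.BN
      (K.diffUnit X tf hZ hP hBΛ DS IG gS gSs NH AB A₀ hA₀ hA₀' h)))
        (K.toUnits_diffUnit_mem_rootsOfUnity X tf hZ hP hBΛ DS IG gS gSs NH AB A₀ hA₀ hA₀' h))
  rw [K.kummerCocycle_restrict_eq' X tf hZ hP hBΛ DS IG gS gSs NH AB A₀ hA₀ hA₀' h]

/-- **"In particular, this cohomology class is independent of the … conjugation operations discussed in (ii)"**, with NO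
divisoriality hypothesis: any two bi-Kummer `N`-th roots `K, K'` of the same `N`-th root of a fraction-pair (in particular
any two related by the conjugations (a), (b) of Prop 4.3 (ii)) determine the same class — both are `κ_{f|_{B_N}}`.
[cite: MochizukiEtTh2009, Prop 4.3 (iii) p.317 (PDF p.91)] -/
theorem diffClass_eq_of_biKummerRoot' (K' : (mkOfModel X tf hZ hP hBΛ DS IG gS gSs NH AB A₀ hA₀ hA₀').BiKummerRoot R hA hB) :
    H1π _ (cocyclesOfIsMulCocycle₁ (K.isMulCocycle₁_diffUnit X tf hZ hP hBΛ DS IG gS gSs NH AB A₀ hA₀ hA₀')) =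
      H1π _ (cocyclesOfIsMulCocycle₁ (K'.isMulCocycle₁_diffUnit X tf hZ hP hBΛ DS IG gS gSs NH AB A₀ hA₀ hA₀')) := by
  rw [← K.kummerClassOfRoot_restrict_eq' X tf hZ hP hBΛ DS IG gS gSs NH AB A₀ hA₀ hA₀',
    ← K'.kummerClassOfRoot_restrict_eq' X tf hZ hP hBΛ DS IG gS gSs NH AB A₀ hA₀ hA₀']

/-- Agreement with abc-iut-L2-t3's named twisted homomorphism `diffCocycle` whenever its divisoriality argument IS
supplied: the two have the same values (so `kummerClassOfRoot_restrict_eq'` refines `kummerClassOfRoot_restrict_eq`).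
[cite: MochizukiEtTh2009, Prop 4.3 (iii) p.317 (PDF p.91)] -/
theorem diffCocycle_eq_mk (hΦd : Objectwise (fun M _ => IsDivisorial M) tf.divisorMonoid)
    (h : (mkOfModel X tf hZ hP hBΛ DS IG gS gSs NH AB A₀ hA₀ hA₀').HA R.BN hB) :
    K.diffCocycle X tf hZ hP hBΛ DS IG gS gSs NH AB A₀ hA₀ hA₀' hΦd h =
      Kummer.Mu.mk (toUnits (BiratCoeff.of R.BN (K.diffUnit X tf hZ hP hBΛ DS IG gS gSs NH AB A₀ hA₀ hA₀' h)))
        (K.toUnits_diffUnit_mem_rootsOfUnity X tf hZ hP hBΛ DS IG gS gSs NH AB A₀ hA₀ hA₀' h) :=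
  Kummer.Mu.ext rfl

end KummerClass

end BiKummerRoot

/-! ### §3. At the §5 data of record `mkOfConnectedTemperoid` (`= mkOfModelCanonical = mkOfModel` definitionally)

The `H¹`-valued statements of this section name the model arguments of `mkOfConnectedTemperoid` through its own
projections (`DisjointSupports`, `IsGaloisObj`, `galoisSurj`, `galoisSurj_surjective`, `ArisesFromBaseFrobeniusPair`;
all reduce definitionally), which keeps the defining unfolding cheap for the kernel. -/

section Connected

variable {K : Type u₀} [Field K]
  (X : SemiGraphs.TemperedArithmeticGroup.{u₀} K) {D₀ : Type u₀} [Category.{v₀} D₀]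
  {V : FrdIMonoidStub.{w}} {T : RealifiedDivisorMonoids (D₀ := D₀) V}
  {VD : FrdICatStub.{u₀ + 1, u₀, w} (ConnectedPart (BTemp X.Pi))}
  (tf : TemperedFrobenioid T (ConnectedPart (BTemp X.Pi)) VD) (hZ : tf.monoidType = MonoidType.Z)
  (hP : ∀ A : (ConnectedPart (BTemp X.Pi))ᵒᵖ, IsPerfect (tf.Φ.carrier A))
  (NH : Subgroup (Field.absoluteGaloisGroup K) → tf.category → ℕ+ → Prop) (A₀ : tf.category)
  (hA₀ : PreFrobenioid.IsFrobeniusTrivial tf.toElem A₀) (hA₀' : SemiGraphs.IsGaloisObj A₀.base.obj)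
  {A B : (mkOfConnectedTemperoid X tf hZ hP NH A₀ hA₀ hA₀').C}
  {f : (mkOfConnectedTemperoid X tf hZ hP NH A₀ hA₀ hA₀').biratUnits A}
  {P : (mkOfConnectedTemperoid X tf hZ hP NH A₀ hA₀ hA₀').FractionPair f B} {N : ℕ+}
  {pullFrac : ∀ {A A' : (mkOfConnectedTemperoid X tf hZ hP NH A₀ hA₀ hA₀').C} (_ : A' ⟶ A),
    (mkOfConnectedTemperoid X tf hZ hP NH A₀ hA₀ hA₀').biratUnits A →
      (mkOfConnectedTemperoid X tf hZ hP NH A₀ hA₀ hA₀').biratUnits A'}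
  {R : (mkOfConnectedTemperoid X tf hZ hP NH A₀ hA₀ hA₀').NthRoot f P N pullFrac}
  {hA : (mkOfConnectedTemperoid X tf hZ hP NH A₀ hA₀ hA₀').IsGalois R.AN}
  {hB : (mkOfConnectedTemperoid X tf hZ hP NH A₀ hA₀ hA₀').IsGalois R.BN}
  (Kr : (mkOfConnectedTemperoid X tf hZ hP NH A₀ hA₀ hA₀').BiKummerRoot R hA hB)

/-- At the §5 data of record, `f|_{B_N} = g^N` is `H_{B_N}`-fixed for every `N`-th root carrying a bi-Kummer root — no
hypothesis beyond the structure's own data (any universes). [cite: MochizukiEtTh2009, Prop 4.3 (iii) p.317 (PDF p.91)] -/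
theorem isFixedByHA_restrict_pow_mkOfConnectedTemperoid
    (Kr : (mkOfConnectedTemperoid X tf hZ hP NH A₀ hA₀ hA₀').BiKummerRoot R hA hB) :
    (mkOfConnectedTemperoid X tf hZ hP NH A₀ hA₀ hA₀').IsFixedByHA R.BN hB (R.pair.restrict ^ (N : ℕ)) :=
  Kr.isFixedByHA_restrict_pow_mkOfModel' X tf hZ hP _ _ _ _ _ NH _ A₀ hA₀ hA₀'

end Connected

section ConnectedH1

variable {K : Type} [Field K]
  (X : SemiGraphs.TemperedArithmeticGroup.{0} K) {D₀ : Type} [Category.{v₀} D₀]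
  {V : FrdIMonoidStub.{0}} {T : RealifiedDivisorMonoids (D₀ := D₀) V}
  {VD : FrdICatStub.{1, 0, 0} (ConnectedPart (BTemp X.Pi))}
  (tf : TemperedFrobenioid T (ConnectedPart (BTemp X.Pi)) VD) (hZ : tf.monoidType = MonoidType.Z)
  (hP : ∀ A : (ConnectedPart (BTemp X.Pi))ᵒᵖ, IsPerfect (tf.Φ.carrier A))
  (NH : Subgroup (Field.absoluteGaloisGroup K) → tf.category → ℕ+ → Prop) (A₀ : tf.category)
  (hA₀ : PreFrobenioid.IsFrobeniusTrivial tf.toElem A₀) (hA₀' : SemiGraphs.IsGaloisObj A₀.base.obj)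
  {A B : (mkOfConnectedTemperoid X tf hZ hP NH A₀ hA₀ hA₀').C}
  {f : (mkOfConnectedTemperoid X tf hZ hP NH A₀ hA₀ hA₀').biratUnits A}
  {P : (mkOfConnectedTemperoid X tf hZ hP NH A₀ hA₀ hA₀').FractionPair f B} {N : ℕ+}
  {pullFrac : ∀ {A A' : (mkOfConnectedTemperoid X tf hZ hP NH A₀ hA₀ hA₀').C} (_ : A' ⟶ A),
    (mkOfConnectedTemperoid X tf hZ hP NH A₀ hA₀ hA₀').biratUnits A →
      (mkOfConnectedTemperoid X tf hZ hP NH A₀ hA₀ hA₀').biratUnits A'}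
  {R : (mkOfConnectedTemperoid X tf hZ hP NH A₀ hA₀ hA₀').NthRoot f P N pullFrac}
  {hA : (mkOfConnectedTemperoid X tf hZ hP NH A₀ hA₀ hA₀').IsGalois R.AN}
  {hB : (mkOfConnectedTemperoid X tf hZ hP NH A₀ hA₀ hA₀').IsGalois R.BN}
  (Kr : (mkOfConnectedTemperoid X tf hZ hP NH A₀ hA₀ hA₀').BiKummerRoot R hA hB)

/-- **At the §5 data of record** (Hom- and monoid-universe `0`): the value at `h ∈ H_{B_N}` of the [FrdII] Def 2.1 (ii) Kummer
cocycle of `f|_{B_N}` attached to the root `g = f_N|_{B_N}` has underlying rational function `unit (s''(h)·s'(h)⁻¹)` —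
"the difference determines a twisted homomorphism `H_{B_N} → μ_N(B_N)`", no binder beyond the structure's own data.
[cite: MochizukiEtTh2009, Prop 4.3 (iii) p.317 (PDF p.91)] -/
theorem val_kummerCocycle_restrict_mkOfConnectedTemperoid
    (h : (mkOfConnectedTemperoid X tf hZ hP NH A₀ hA₀ hA₀').HA R.BN hB) :
    (((Kummer.kummerCocycle (BiratCoeff.nthRootsDifferByUnits _ R.BN N)
        ((mkOfConnectedTemperoid X tf hZ hP NH A₀ hA₀ hA₀').HA R.BN hB)
        (f := BiratCoeff.of R.BN (R.pair.restrict ^ (N : ℕ))) (g := BiratCoeff.of R.BN R.pair.restrict) rfl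
        (BiratCoeff.smul_of_eq_of_isFixedByHA
          (isFixedByHA_restrict_pow_mkOfConnectedTemperoid X tf hZ hP NH A₀ hA₀ hA₀' Kr)) h).val :
        (mkOfConnectedTemperoid X tf hZ hP NH A₀ hA₀ hA₀').BiratCoeff R.BN) :
          (mkOfConnectedTemperoid X tf hZ hP NH A₀ hA₀ hA₀').biratUnits R.BN).val =
      ModelFrobenioid.unit (Kr.sDen h * (Kr.sNum h)⁻¹ : Aut R.BN).hom :=
  Kr.val_kummerCocycle_restrict X tf hZ hP T.isUnit_BΛ
      (fun {A₁} a b => (mkOfConnectedTemperoid X tf hZ hP NH A₀ hA₀ hA₀').DisjointSupports (A := A₁) a b)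
      (mkOfConnectedTemperoid X tf hZ hP NH A₀ hA₀ hA₀').IsGaloisObj
      (mkOfConnectedTemperoid X tf hZ hP NH A₀ hA₀ hA₀').galoisSurj
      (mkOfConnectedTemperoid X tf hZ hP NH A₀ hA₀ hA₀').galoisSurj_surjective NH
      (fun {A₁ B₁} G α₂ α₁ =>
        (mkOfConnectedTemperoid X tf hZ hP NH A₀ hA₀ hA₀').ArisesFromBaseFrobeniusPair (A := A₁) (B := B₁) G α₂ α₁)
      A₀ hA₀ hA₀' h

/-- **[EtTh] Prop 4.3 (iii), SECOND CLAUSE, at the §5 data of record `mkOfConnectedTemperoid` with NO binder beyond the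
structure's own data** (Hom- and monoid-universe `0`): `κ_{f|_{B_N}}` = the class of the twisted homomorphism `h ↦ u_{w(h)}`
determined by the bi-Kummer difference, for EVERY `N`-th root `R` and EVERY bi-Kummer root of it.
[cite: MochizukiEtTh2009, Prop 4.3 (iii) p.317 (PDF p.91)] -/
theorem kummerClassOfRoot_restrict_eq_mkOfConnectedTemperoid :
    (mkOfConnectedTemperoid X tf hZ hP NH A₀ hA₀ hA₀').kummerClassOfRoot hB (N : ℕ)
        (f := R.pair.restrict ^ (N : ℕ)) (g := R.pair.restrict) rfl
        (isFixedByHA_restrict_pow_mkOfConnectedTemperoid X tf hZ hP NH A₀ hA₀ hA₀' Kr) =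
      H1π _ (cocyclesOfIsMulCocycle₁ (Kr.isMulCocycle₁_diffUnit X tf hZ hP T.isUnit_BΛ
      (fun {A₁} a b => (mkOfConnectedTemperoid X tf hZ hP NH A₀ hA₀ hA₀').DisjointSupports (A := A₁) a b)
      (mkOfConnectedTemperoid X tf hZ hP NH A₀ hA₀ hA₀').IsGaloisObj
      (mkOfConnectedTemperoid X tf hZ hP NH A₀ hA₀ hA₀').galoisSurj
      (mkOfConnectedTemperoid X tf hZ hP NH A₀ hA₀ hA₀').galoisSurj_surjective NH
      (fun {A₁ B₁} G α₂ α₁ =>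
        (mkOfConnectedTemperoid X tf hZ hP NH A₀ hA₀ hA₀').ArisesFromBaseFrobeniusPair (A := A₁) (B := B₁) G α₂ α₁)
      A₀ hA₀ hA₀')) :=
  Kr.kummerClassOfRoot_restrict_eq' X tf hZ hP T.isUnit_BΛ
      (fun {A₁} a b => (mkOfConnectedTemperoid X tf hZ hP NH A₀ hA₀ hA₀').DisjointSupports (A := A₁) a b)
      (mkOfConnectedTemperoid X tf hZ hP NH A₀ hA₀ hA₀').IsGaloisObj
      (mkOfConnectedTemperoid X tf hZ hP NH A₀ hA₀ hA₀').galoisSurj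
      (mkOfConnectedTemperoid X tf hZ hP NH A₀ hA₀ hA₀').galoisSurj_surjective NH
      (fun {A₁ B₁} G α₂ α₁ =>
        (mkOfConnectedTemperoid X tf hZ hP NH A₀ hA₀ hA₀').ArisesFromBaseFrobeniusPair (A := A₁) (B := B₁) G α₂ α₁)
      A₀ hA₀ hA₀'

/-- **"In particular"** at the §5 data of record: any two bi-Kummer roots of the same `N`-th root determine the same class.
[cite: MochizukiEtTh2009, Prop 4.3 (iii) p.317 (PDF p.91)] -/
theorem diffClass_eq_of_biKummerRoot_mkOfConnectedTemperoid
    (Kr' : (mkOfConnectedTemperoid X tf hZ hP NH A₀ hA₀ hA₀').BiKummerRoot R hA hB) :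
    H1π _ (cocyclesOfIsMulCocycle₁ (Kr.isMulCocycle₁_diffUnit X tf hZ hP T.isUnit_BΛ
      (fun {A₁} a b => (mkOfConnectedTemperoid X tf hZ hP NH A₀ hA₀ hA₀').DisjointSupports (A := A₁) a b)
      (mkOfConnectedTemperoid X tf hZ hP NH A₀ hA₀ hA₀').IsGaloisObj
      (mkOfConnectedTemperoid X tf hZ hP NH A₀ hA₀ hA₀').galoisSurj
      (mkOfConnectedTemperoid X tf hZ hP NH A₀ hA₀ hA₀').galoisSurj_surjective NH
      (fun {A₁ B₁} G α₂ α₁ =>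
        (mkOfConnectedTemperoid X tf hZ hP NH A₀ hA₀ hA₀').ArisesFromBaseFrobeniusPair (A := A₁) (B := B₁) G α₂ α₁)
      A₀ hA₀ hA₀')) =
      H1π _ (cocyclesOfIsMulCocycle₁ (Kr'.isMulCocycle₁_diffUnit X tf hZ hP T.isUnit_BΛ
      (fun {A₁} a b => (mkOfConnectedTemperoid X tf hZ hP NH A₀ hA₀ hA₀').DisjointSupports (A := A₁) a b)
      (mkOfConnectedTemperoid X tf hZ hP NH A₀ hA₀ hA₀').IsGaloisObj
      (mkOfConnectedTemperoid X tf hZ hP NH A₀ hA₀ hA₀').galoisSurj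
      (mkOfConnectedTemperoid X tf hZ hP NH A₀ hA₀ hA₀').galoisSurj_surjective NH
      (fun {A₁ B₁} G α₂ α₁ =>
        (mkOfConnectedTemperoid X tf hZ hP NH A₀ hA₀ hA₀').ArisesFromBaseFrobeniusPair (A := A₁) (B := B₁) G α₂ α₁)
      A₀ hA₀ hA₀')) :=
  Kr.diffClass_eq_of_biKummerRoot' X tf hZ hP T.isUnit_BΛ
      (fun {A₁} a b => (mkOfConnectedTemperoid X tf hZ hP NH A₀ hA₀ hA₀').DisjointSupports (A := A₁) a b)
      (mkOfConnectedTemperoid X tf hZ hP NH A₀ hA₀ hA₀').IsGaloisObj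
      (mkOfConnectedTemperoid X tf hZ hP NH A₀ hA₀ hA₀').galoisSurj
      (mkOfConnectedTemperoid X tf hZ hP NH A₀ hA₀ hA₀').galoisSurj_surjective NH
      (fun {A₁ B₁} G α₂ α₁ =>
        (mkOfConnectedTemperoid X tf hZ hP NH A₀ hA₀ hA₀').ArisesFromBaseFrobeniusPair (A := A₁) (B := B₁) G α₂ α₁)
      A₀ hA₀ hA₀' Kr'

end ConnectedH1

end BiKummerSetting

end Literature.AnabelianGeometry.EtaleTheta

end
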